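import Literature.MathematicalPhysics.QuantumFieldTheory.Balaban1983to89.B14Eq216Concrete
import Literature.MathematicalPhysics.QuantumFieldTheory.Balaban1983to89.B16Sect1Backgrounds
import Literature.MathematicalPhysics.QuantumFieldTheory.Balaban1983to89.B14Eq16FaddeevPopov

/-!
# `Balaban1983to89.B15Eq177GaugeInvariance` — T. Bałaban, *Large field renormalization. I. The basic step of the 𝐑 operation*,
# Commun. Math. Phys. **122** (1989) 175–202 [Balaban1989LargeFieldI] = «[IV]», (1.77) p. 194: *"The function is invariant with
# respect to the group of all gauge transformations defined on Λ"* — PROVED for the function `V_k ↦ A(U_{k,Z}(V_k))` of (1.77)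
# at print's instance (`U_{k,Z}(V_k) = U(𝐁_k(Z), M˙(Q_k^{s*}V_k))`, (1.74)), from three kernel theorems — the gauge invariance of
# the Wilson action (`B14Eq16FaddeevPopov.wilsonAction4_gaugeAct'`), the gauge covariance of `Q_k^{s*}` (`qsstarGIter0_gaugeAct`,
# here — the `qsstarGIter0` counterpart of p31's `qsstarGIter_gaugeAct`, from p31's one-step `qsstarG_gaugeAct`) and of the
# averages `M˙` (r13's `B16Sect1Backgrounds.iter_gaugeAct`) — over ONE named, located hypothesis on the [15] datum: the
# covariance (181) of [Balaban1985Variational] of the solution map `U(𝐁, ·)`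

statement-level skeleton of published theorems with citation tags; proofs where landed; nothing here is a claim about
the Yang–Mills mass gap

PDF held: `paper:balaban1989-cmp122-large-field-i` (journal page = PDF page + 174), p. 194 [PDF 20] read as image on the ×2
render `run/shared/lean/pub/pub-balaban/b2b-balaban-ref1/pages/1989-cmp122-large-field-I/1989-cmp122-large-field-I-p020-x2.png`;
[15] = T. Bałaban, *The variational problem and background fields in renormalization group method for lattice gauge theories*,
Commun. Math. Phys. **102** (1985) 277–309 [Balaban1985Variational], (181) p. 307 (SKELETON row B11.Eq181): *"For the minimal
configurations in the axial gauge we have U_k(V^v) = U_k(V)^{v̄}, (181) where v̄ is constant on blocks B^j(y), y ∈ Λ_j, and equal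
to v(y)"*.

CITATION HEADER / WHAT IS REPRODUCED (mega-formalization `lit-balaban`, HOME `run/shared/lean/pub/lit-balaban/`; unit
`lit-balaban-r11` gen 109, PROXY CONSTITUENT for block B15 under the lead's ruling G.5-61; this file answers the lead's head word
Q-B15-r11-2 (HOME/STATUS 2026-08-24T19:44:23Z (4)): *"the gauge invariance of the Wilson action and the covariances of Q^{s*} and
M˙ must be kernel theorems cited BY NAME in the SCOPE; with all three in the tree the row reads `proved …` … over the named
(181)[15] covariance hypothesis"*).  SKELETON row served: **B15.Eq1.77** (r12's `B15DeterminingSets.fun177` p243299; print's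
instance = `fun177 bg (Bj M₁ Z k) (qsstarGIter0 k)`, cf. `B15Sect1Instances.fun177std` filed the same day).

THE PRINT (p. 194 [PDF 20], verbatim): *"Consider the function V_k↾_Λ → A(U_{k,Z}(V_k)). (1.77) It is defined on configurations
V_k satisfying mild regularity conditions, e.g., |∂V_k − 1| < a₁ on Z. The function is invariant with respect to the group of all
gauge transformations defined on Λ, hence it is natural to consider it on orbits of this group. We look for a minimal orbit"*.

WHAT IS PROVED.  §1 `blockLift k u` = the block-constant extension `ū = u ∘ B^k` of a gauge transformation `u` of `T^{(k)}` to
`T_η` ([15] (181)'s *"v̄ is constant on blocks … and equal to v(y)"*), and **`qsstarGIter0_gaugeAct`**: `Q_k^{s*}(V_k^u) =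
(Q_k^{s*}V_k)^{ū}` (standing range `k ≤ m + K`), by induction from p31's one-step `qsstarG_gaugeAct`.  §2 the (181) hypothesis
on the datum `bg : DetBackground` for the determining set `𝐁_k(Z)`, in the form the chain uses: `Cov181 bg 𝔹 ū` = *for
multi-scale data `V, V′` with `V′_i = V_i^{ū↾T^{(i)}}` on every scale of the `Params` range, `U(𝔹, V′) = U(𝔹, V)^{ū}`* (the
restriction to the range `i ≤ m + K` is the `Setup` RANGE GUARD, DIVERGENCE F16 — above it the averaging axioms are void, as in
r13's `B16Sect1Backgrounds.avgFamily_U0AL_apply`).  §3 **`bgKZ_gaugeAct`**: `U_{k,Z}(V_k^u) = U_{k,Z}(V_k)^{ū}` and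
**`fun177_gaugeAct`**: `A(U_{k,Z}(V_k^u)) = A(U_{k,Z}(V_k))` for EVERY gauge transformation `u` of `T^{(k)}` (in particular those
*"defined on Λ"*, i.e. equal to `1` off `Λ`), over `Cov181`; **`isVLambda_gaugeAct`**: a minimizer of Proposition 1 stays a
minimizer under gauge transformations supported on `Λ` (print: *"hence it is natural to consider it on orbits of this
group. We look for a minimal orbit"*).  No `sorry`, no `Prop` fact (`Cov181` is a HYPOTHESIS of the theorems, displayed and located, never asserted), no new
axiom; nothing of r12's / r13's / p31's files is restated.

v1.1 (same seat, same day; theorems only, statements of v1 untouched): §1 `blockIter_embIter` (`B^k` of the embedded centre `y` is `y`,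
standing range) and `toMS_blockLift_self` — [15] (181)'s *"v̄ … equal to v(y)"*: the block-constant lift restricted back to `T^{(k)}`
IS `u`; §2 `Cov181.apply_of_toMS_eq` — the junction to r13's `B16Sect1Backgrounds.eq125` binder `h181`: `Cov181` is its universal
closure ([LF-II] = [Balaban1989LargeFieldII] (1.25) p. 362 *"ū₀ … equal to u₀ at centers of the blocks"* is exactly the agreement
hypothesis).  Located by the DEFINITIONS steward r20 gen 66 (`lit-balaban-r11/INBOX.md` 2026-08-24T20:59:29Z).
v1.2 DOCFIX (referee-5 gen 106, F-g106-1): the centres sentence is [LF-II] (1.25) p. 362 (as r13's `B16Sect1Backgrounds` cites it), not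
[IV] (1.25) p. 181 (which is the integral display of p. 182) — header line and the cite tag of `Cov181.apply_of_toMS_eq` retagged; no
declaration touched.
-/

noncomputable section

namespace Literature.MathematicalPhysics.QuantumFieldTheory.Balaban1983to89.B15Eq177GaugeInvariance

open Literature.MathematicalPhysics.QuantumFieldTheory.Balaban1983to89
open B15DeterminingSets B14.Eq213DetSet B14.Eq216Concrete B14.Eq22Determines GaugeField
open Literature.MathematicalPhysics.QuantumFieldTheory.BalabanImbrieJaffe1984to88.BIJ85Eq453GaugeField

variable {P : Params} {G : Type*}

/-! ## §1  The block-constant extension `ū = u ∘ B^k` and the covariance of `Q_k^{s*}` -/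

/-- [15] (181) p. 307: *"v̄ is constant on blocks B^j(y), y ∈ Λ_j, and equal to v(y)"* — the block-constant extension of a gauge
transformation `u` of `T^{(k)}` to the fine lattice `T_η`: `ū(x) = u(B^k(x))` (`B^k = blockIter k`). [cite: Balaban1985Variational, (181) p.307] -/
def blockLift (k : ℕ) (u : GaugeTransf P k G) : GaugeTransf P 0 G := fun x => u (blockIter k x)

/-- `ū` at scale `0` is `u` itself. [cite: Balaban1985Variational, (181) p.307] -/
@[simp] theorem blockLift_zero (u : GaugeTransf P 0 G) : blockLift 0 u = u := rfl

/-- `blockLift (k+1) u = blockLift k (u ∘ blockOf)` (definitional: `B^{k+1}(x) = B(B^k(x))`). [cite: Balaban1985Variational, (181) p.307] -/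
theorem blockLift_succ (k : ℕ) (u : GaugeTransf P (k + 1) G) :
    blockLift (k + 1) u = blockLift k (fun x => u (blockOf x)) := rfl

variable [GaugeGroup G]

/-- **Gauge covariance of `Q_k^{s*}`** ([III] (1.3) with `k`-blocks; [Balaban1987RG1] p. 252 *"Q^{s*}_k(V^g) = (Q^{s*}_kV)^{g∘B^k}"*):
`Q_k^{s*}(V_k^u) = (Q_k^{s*}V_k)^{ū}` in the standing range `k ≤ m + K` — by induction on `k` from p31's one-step
`BIJ85Eq453GaugeField.qsstarG_gaugeAct`.  This is the base-`0` (`qsstarGIter0`, target `T_η = Site P 0`) counterpart of p31's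
base-`i` `BIJ85Eq453GaugeField.qsstarGIter_gaugeAct` (carrier `qsstarGIter`, source level `i + k`); it is the form (1.74)/(1.77)
consume (`bgKZ … (qsstarGIter0 k)`), the two carriers being distinct definitions in p31's file.
[cite: BalabanImbrieJaffe1988, (4.17) p.277; Balaban1988Convergent, (1.3) p.246] -/
theorem qsstarGIter0_gaugeAct : ∀ (k : ℕ), k ≤ P.m + P.K → ∀ (u : GaugeTransf P k G) (V : GaugeField P k G),
    qsstarGIter0 k (gaugeAct u V) = gaugeAct (blockLift k u) (qsstarGIter0 k V)
  | 0, _, _, _ => rfl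
  | k + 1, hk, u, V => by
      rw [qsstarGIter0_succ, qsstarGIter0_succ, qsstarG_gaugeAct hk u V,
        qsstarGIter0_gaugeAct k (Nat.le_of_succ_le hk) _ (qsstarG V), blockLift_succ]

/-- `B^k(y) = y` for a centre `y ∈ T^{(k)}` viewed in `T_η` (`blockIter k ∘ embIter k = id`, standing range `k ≤ m + K`; r04's
`B4Eq15Projection.blockOfIter_embIter` is the base-`i` analogue). [cite: Balaban1985Variational, (181) p.307] -/
theorem blockIter_embIter : ∀ (k : ℕ), k ≤ P.m + P.K → ∀ y : Site P k, blockIter k (embIter k y) = y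
  | 0, _, _ => rfl
  | k + 1, hk, y => by
      show blockOf (blockIter k (embIter k (emb y))) = y
      rw [blockIter_embIter k (Nat.le_of_succ_le hk), Site.blockOf_emb hk]

omit [GaugeGroup G] in
/-- [15] (181) verbatim *"v̄ is constant on blocks B^j(y), y ∈ Λ_j, and equal to v(y)"*: the block-constant lift `ū` restricted back
to the scale-`k` sites (r13's `B16Sect1Backgrounds.toMS ū k`) IS `u`. [cite: Balaban1985Variational, (181) p.307] -/
theorem toMS_blockLift_self {k : ℕ} (hk : k ≤ P.m + P.K) (u : GaugeTransf P k G) :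
    B16Sect1Backgrounds.toMS (blockLift k u) k = u := by
  funext y
  show u (blockIter k (embIter k y)) = u y
  rw [blockIter_embIter k hk]

/-! ## §2  The hypothesis: [15] (181), covariance of the solution map, for the determining set at hand -/

/-- **[15] (181)** p. 307, verbatim: *"For the minimal configurations in the axial gauge we have U_k(V^v) = U_k(V)^{v̄}, (181) where v̄
is constant on blocks B^j(y), y ∈ Λ_j, and equal to v(y)"* — as a HYPOTHESIS on the [III] (2.12) solution datum `bg` for the
determining set `𝔹` and a fine-lattice gauge transformation `ū`: whenever two multi-scale data agree up to the gauge transformation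
`ū↾T^{(i)}` (`B16Sect1Backgrounds.toMS ū i`) on every scale of the `Params` range (`i ≤ m + K`; above it the `Setup` averaging axioms
are void — RANGE GUARD, DIVERGENCE F16), the minimal configurations differ by `ū`.  NOT asserted (an imported result of [15], carried
as a named, located hypothesis — the lead's B12-Q9 species, as in r13's `B16Sect1Backgrounds.eq125` `h181`).  The MECHANISM of (181) —
gauge-invariant functional, equivariant admissible sets, UNIQUE constrained minimiser ⇒ equivariant minimiser — is PROVED in abstract form as
r08's `B11Eq181Covariance.minimiser_smul` (row B11.Eq181); the datum `DetBackground` records a minimiser of each problem but not its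
uniqueness ([15] Theorem 1), which is why (181) is a hypothesis on the datum here and not a consequence. [cite: Balaban1985Variational, (181) p.307] -/
def Cov181 {av : ∀ j, Averaging P j G} (bg : DetBackground P G av) (𝔹 : DetSet P) (ubar : GaugeTransf P 0 G) : Prop :=
  ∀ V V' : MSField P G, (∀ i, i ≤ P.m + P.K → V' i = gaugeAct (B16Sect1Backgrounds.toMS ubar i) (V i)) →
    bg.U 𝔹 V' = gaugeAct ubar (bg.U 𝔹 V)

/-- JUNCTION to r13's `B16Sect1Backgrounds.eq125` (its binder `h181`): `Cov181` is the universal closure of that hypothesis — for any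
fine gauge transformation `u₀` agreeing with `ū` scale by scale in the `Params` range ([LF-II] (1.25) p. 362: *"ū₀ … equal to u₀ at
centers of the blocks"*), `U(𝔹, V^{u₀}) = U(𝔹, V)^{ū}`. [cite: Balaban1989LargeFieldII, (1.25) p.362; Balaban1985Variational, (181) p.307] -/
theorem Cov181.apply_of_toMS_eq {av : ∀ j, Averaging P j G} {bg : DetBackground P G av} {𝔹 : DetSet P} {ubar : GaugeTransf P 0 G}
    (h : Cov181 bg 𝔹 ubar) {u₀ : GaugeTransf P 0 G}
    (hc : ∀ i, i ≤ P.m + P.K → B16Sect1Backgrounds.toMS u₀ i = B16Sect1Backgrounds.toMS ubar i) (V : MSField P G) :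
    bg.U 𝔹 (B16Sect1Backgrounds.msGaugeAct (B16Sect1Backgrounds.toMS u₀) V) = gaugeAct ubar (bg.U 𝔹 V) :=
  h V _ fun i hi => by rw [← hc i hi]; rfl

/-! ## §3  (1.77): gauge covariance of `U_{k,Z}` and gauge invariance of `A(U_{k,Z}(V_k))` -/

section Eq177

variable {av : ∀ j, Averaging P j G} (bg : DetBackground P G av) (M₁ : ℕ)

/-- **Covariance of (1.74)**: `U_{k,Z}(V_k^u) = (U_{k,Z}(V_k))^{ū}` for `U_{k,Z}(V_k) = U(𝐁_k(Z), M˙(Q_k^{s*}V_k))` at print's instance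
(`bgKZ bg (Bj M₁ Z k) (qsstarGIter0 k)`), `k ≤ m + K` — the chain `Q_k^{s*}(V^u) = (Q_k^{s*}V)^{ū}` (`qsstarGIter0_gaugeAct`) ∘
`M˙((·)^{ū}) = M˙(·)^{ū↾}` (`iter_gaugeAct`) ∘ (181) (`Cov181`, hypothesis). [cite: Balaban1989LargeFieldI, (1.74) p.192, (1.77) p.194] -/
theorem bgKZ_gaugeAct {Z : Set (Site P 0)} {k : ℕ} (hk : k ≤ P.m + P.K) (u : GaugeTransf P k G)
    (h181 : Cov181 bg (Bj M₁ Z k) (blockLift k u)) (Vk : GaugeField P k G) :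
    bgKZ bg (Bj M₁ Z k) (qsstarGIter0 k) (gaugeAct u Vk) =
      gaugeAct (blockLift k u) (bgKZ bg (Bj M₁ Z k) (qsstarGIter0 k) Vk) := by
  unfold bgKZ
  rw [qsstarGIter0_gaugeAct k hk u Vk]
  -- `M˙` is gauge covariant scale by scale in the `Params` range: r13's kernel theorem `B16Sect1Backgrounds.iter_gaugeAct`
  exact h181 _ _ fun i hi => B16Sect1Backgrounds.iter_gaugeAct av (blockLift k u) (qsstarGIter0 k Vk) i hi

/-- **(1.77) p. 194, verbatim: *"The function is invariant with respect to the group of all gauge transformations defined on Λ"*** —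
PROVED at print's instance for EVERY gauge transformation `u` of `T^{(k)}` (`k ≤ m + K`), over the named [15] (181) hypothesis:
`A(U_{k,Z}(V_k^u)) = A(U_{k,Z}(V_k))` (`fun177` = r12's (1.77) WITH BODY; the Wilson-action invariance is the kernel theorem
`B14Eq16FaddeevPopov.wilsonAction4_gaugeAct'`). [cite: Balaban1989LargeFieldI, (1.77) p.194] -/
theorem fun177_gaugeAct {Z : Set (Site P 0)} {k : ℕ} (hk : k ≤ P.m + P.K) (u : GaugeTransf P k G)
    (h181 : Cov181 bg (Bj M₁ Z k) (blockLift k u)) (Vk : GaugeField P k G) :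
    fun177 bg (Bj M₁ Z k) (qsstarGIter0 k) (gaugeAct u Vk) = fun177 bg (Bj M₁ Z k) (qsstarGIter0 k) Vk := by
  unfold fun177
  rw [bgKZ_gaugeAct bg M₁ hk u h181 Vk, B14Eq16FaddeevPopov.wilsonAction4_gaugeAct']

/-- (1.77) as `GaugeField.GaugeInvariant` ([12] (12)–(13)) of the function `V_k ↦ A(U_{k,Z}(V_k))`, when (181) holds for every block-
constant `ū`. [cite: Balaban1989LargeFieldI, (1.77) p.194] -/
theorem gaugeInvariant_fun177 {Z : Set (Site P 0)} {k : ℕ} (hk : k ≤ P.m + P.K)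
    (h181 : ∀ u : GaugeTransf P k G, Cov181 bg (Bj M₁ Z k) (blockLift k u)) :
    GaugeInvariant (fun177 bg (Bj M₁ Z k) (qsstarGIter0 k)) :=
  fun u Vk => fun177_gaugeAct bg M₁ hk u (h181 u) Vk

/-- A gauge transformation of `T^{(k)}` *"defined on Λ"* (equal to `1` off `Λ^{(k)}`) does not move the bond variables off the bonds
meeting `Λ^{(k)}` — so it acts on the variables `V_k↾_Λ` of (1.77) only. [cite: Balaban1989LargeFieldI, (1.77) p.194] -/
theorem gaugeAct_eq_of_not_mem {k : ℕ} {Λ : Set (Site P 0)} {u : GaugeTransf P k G} (hu : ∀ y, y ∉ pts k Λ → u y = 1)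
    (Vk : GaugeField P k G) {b : PBond P k} (hb : b ∉ bondsOf (pts k Λ)) : gaugeAct u Vk b = Vk b := by
  have hs : b.src ∉ pts k Λ := fun h => hb (Or.inl h)
  have ht : b.tgt ∉ pts k Λ := fun h => hb (Or.inr h)
  simp [gaugeAct, hu _ hs, hu _ ht]

/-- p. 194: *"hence it is natural to consider it on orbits of this group. We look for a minimal orbit"* — a minimizer `V_Λ` of (1.77) over the variables `V_k↾_Λ`
(r12's `IsVLambda` at print's instance, the other variables frozen at `V_k↾_{Z∩Λᶜ}`) stays a minimizer under every gauge
transformation supported on `Λ`, over (181): the whole orbit minimizes. [cite: Balaban1989LargeFieldI, (1.77)–(1.78) p.194] -/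
theorem isVLambda_gaugeAct {Z Λ : Set (Site P 0)} {k : ℕ} (hk : k ≤ P.m + P.K) {u : GaugeTransf P k G}
    (hu : ∀ y, y ∉ pts k Λ → u y = 1) (h181 : Cov181 bg (Bj M₁ Z k) (blockLift k u))
    {Vout VΛ : GaugeField P k G} (hV : IsVLambda bg (Bj M₁ Z k) (qsstarGIter0 k) (bondsOf (pts k Λ)) Vout VΛ) :
    IsVLambda bg (Bj M₁ Z k) (qsstarGIter0 k) (bondsOf (pts k Λ)) Vout (gaugeAct u VΛ) := by
  refine ⟨fun b hb => ?_, fun W hW => ?_⟩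
  · rw [gaugeAct_eq_of_not_mem hu VΛ hb]
    exact hV.1 b hb
  · rw [fun177_gaugeAct bg M₁ hk u h181 VΛ]
    exact hV.2 W hW

end Eq177

end Literature.MathematicalPhysics.QuantumFieldTheory.Balaban1983to89.B15Eq177GaugeInvariance

end
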